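import Summits.HubbardSuperconductivity.HubbardSuperconductivity.Theorems.FunctionFieldCertificateWindowInfraredBoundEtaGapDomination
import Literature.MathematicalPhysics.QuantumLattice.FreeFermionSectorEnergyDeviation

/-!
# Crux `WindowInfraredBound` (stmt-HubbardSuperconductivity-1089) — the free point `U = 0`, stub S2:
# transfers to strictly lower Bloch levels annihilate EVERY free sector ground state

Support of the R4 calibration `FreeWindowBoundAllGroundStates` (line `free-window-calibration`, skeleton
`Cruxes/WindowInfraredBound/Lines/free_window_calibration.lean`). For the FREE Hubbard torus
`H₀ = hubbardTorus 2 L 1 0 = Σ_{kσ} ε_L(k) n_{kσ}` (`L ≥ 3`, `hubbardTorus_zero_eq_sum_momentumNumber`) and the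
same-spin transfer `X = c†_{kσ} c_{k'σ}` between two Bloch modes `k ≠ k'`:

* `ftv_momentumNumber_mul_transfer` — `n_{pτ} X = X n_{pτ} + (δ_{(p,τ),(k,σ)} − δ_{(p,τ),(k',σ)}) X` (CAR);
* `ftv_hubbardTorus_zero_commutator_transfer` — the exact lowering equation of motion
  `[H₀, X] = (ε_L(k) − ε_L(k')) X`;
* `ftv_transfer_mulVec_mem_szSector` — `X` commutes with `N` and `S^z`, hence maps every joint sector
  `szSector N M` into itself;
* `stub_freeTransferVanishes` (registered stub of the skeleton) — for a ground state `ψ` of `H₀` in the sector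
  `(N, S^z = M)` and `ε_L(k) < ε_L(k')`: `c†_{kσ} c_{k'σ} ψ = 0`. The one-sided KKT lever
  `eucNorm_mulVec_le_of_approxLowering` with `B = X`, `K' = szSector N M`, `ω = ε_L(k') − ε_L(k) > 0` has zero
  remainder `H₀X − XH₀ + ωX = 0`, whence `ω ‖Xψ‖ ≤ 0` and `Xψ = 0`.

Sources: E. H. Lieb, M. Loss, *Analysis* (2001), Thm 1.14 (bathtub / aufbau); J. Bardeen, L. N. Cooper,
J. R. Schrieffer, Phys. Rev. 108 (1957) 1175, §II (Bloch-mode bookkeeping of the Fermi sea). Folklore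
finite-dimensional statements over the tree's definitions; no definition and no named fact is introduced.
-/

noncomputable section

set_option linter.dupNamespace false

namespace Summit.HubbardSuperconductivity.HubbardSuperconductivity.Theorems.WindowInfraredBound

open Matrix Finset
open Literature.Probability.LatticeModels Literature.MathematicalPhysics.QuantumLattice
open scoped ComplexOrder ComplexConjugate

section Transfer

variable {L : ℕ} [NeZero L]

/-- `c†_{kσ} n_{kσ} = 0` (Pauli: `c†_{kσ} c†_{kσ} = 0`). Bratteli–Robinson II §5.2.1. [folklore] -/
theorem ftv_momentumCreation_mul_momentumNumber_self (k : TorusSite 2 L) (σ : Fin 2) :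
    momentumCreation k σ * momentumNumber k σ = 0 := by
  rw [momentumNumber, ← Matrix.mul_assoc, momentumCreation_mul_self, Matrix.zero_mul]

/-- **`[n_{pτ}, c†_{kσ} c_{k'σ}] = (δ_{(p,τ),(k,σ)} − δ_{(p,τ),(k',σ)}) c†_{kσ} c_{k'σ}`** for `k ≠ k'`, in the
form `n X = X n + (δ X − δ' X)`: the transfer raises the occupation of the mode `(k,σ)` and lowers that of
`(k',σ)` (`n_k c†_k = c†_k`, `c†_k n_k = 0`, `n_{k'} c_{k'} = 0`, `c_{k'} n_{k'} = c_{k'}`, and `n_{pτ}` commutes with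
the other modes). Bardeen–Cooper–Schrieffer, Phys. Rev. 108 (1957) 1175, §II. [folklore] -/
theorem ftv_momentumNumber_mul_transfer (p k k' : TorusSite 2 L) (τ σ : Fin 2) (hkk' : k ≠ k') :
    momentumNumber p τ * (momentumCreation k σ * momentumAnnihilation k' σ) =
      momentumCreation k σ * momentumAnnihilation k' σ * momentumNumber p τ +
        ((if τ = σ ∧ p = k then momentumCreation k σ * momentumAnnihilation k' σ else 0) -
          (if τ = σ ∧ p = k' then momentumCreation k σ * momentumAnnihilation k' σ else 0)) := by
  by_cases hk : p = k ∧ τ = σ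
  · -- `(p,τ) = (k,σ)`: `n_k (c†_k c_{k'}) = c†_k c_{k'}` and `c†_k c_{k'} n_k = c†_k n_k c_{k'} = 0`
    have hne : ¬ (k = k' ∧ σ = σ) := fun h => hkk' h.1
    rw [hk.1, hk.2, if_pos ⟨rfl, rfl⟩, if_neg (show ¬ (σ = σ ∧ k = k') from fun h => hkk' h.2), sub_zero,
      ← Matrix.mul_assoc, momentumNumber_mul_momentumCreation_self, Matrix.mul_assoc,
      ← momentumNumber_mul_momentumAnnihilation_of_ne hne, ← Matrix.mul_assoc,
      ftv_momentumCreation_mul_momentumNumber_self, Matrix.zero_mul, zero_add]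
  · by_cases hk' : p = k' ∧ τ = σ
    · -- `(p,τ) = (k',σ)`, `k' ≠ k`: `n_{k'} (c†_k c_{k'}) = c†_k n_{k'} c_{k'} = 0`, `c†_k c_{k'} n_{k'} = c†_k c_{k'}`
      have hne : ¬ (k' = k ∧ σ = σ) := fun h => hk ⟨hk'.1.trans h.1, hk'.2⟩
      rw [hk'.1, hk'.2, if_neg (show ¬ (σ = σ ∧ k' = k) from fun h => hne ⟨h.2, h.1⟩), if_pos ⟨rfl, rfl⟩,
        zero_sub, ← Matrix.mul_assoc, momentumNumber_mul_momentumCreation_of_ne hne, Matrix.mul_assoc,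
        momentumNumber_mul_momentumAnnihilation_self, Matrix.mul_zero, Matrix.mul_assoc,
        momentumAnnihilation_mul_momentumNumber_self, add_neg_cancel]
    · -- any other mode: `n_{pτ}` commutes with both factors
      rw [if_neg (show ¬ (τ = σ ∧ p = k) from fun h => hk ⟨h.2, h.1⟩),
        if_neg (show ¬ (τ = σ ∧ p = k') from fun h => hk' ⟨h.2, h.1⟩), sub_self, add_zero,
        ← Matrix.mul_assoc, momentumNumber_mul_momentumCreation_of_ne hk, Matrix.mul_assoc,
        momentumNumber_mul_momentumAnnihilation_of_ne hk', Matrix.mul_assoc]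

/-- **The transfer is an exact lowering eigen-operator of the free Hamiltonian:
`[H₀, c†_{kσ} c_{k'σ}] = (ε_L(k) − ε_L(k')) c†_{kσ} c_{k'σ}`** for `H₀ = hubbardTorus 2 L 1 0 = Σ_{pτ} ε_L(p) n_{pτ}`
(`L ≥ 3`, `k ≠ k'`): sum the mode commutators `ftv_momentumNumber_mul_transfer` against the band weights.
Bardeen–Cooper–Schrieffer, Phys. Rev. 108 (1957) 1175, §II; Benfatto–Giuliani–Mastropietro (2006) §1.2. [folklore] -/
theorem ftv_hubbardTorus_zero_commutator_transfer (hL : 3 ≤ L) {k k' : TorusSite 2 L} (hkk' : k ≠ k')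
    (σ : Fin 2) :
    hubbardTorus 2 L 1 0 * (momentumCreation k σ * momentumAnnihilation k' σ) -
        momentumCreation k σ * momentumAnnihilation k' σ * hubbardTorus 2 L 1 0 =
      ((torusBand L k - torusBand L k' : ℝ) : ℂ) • (momentumCreation k σ * momentumAnnihilation k' σ) := by
  rw [hubbardTorus_zero_eq_sum_momentumNumber hL]
  simp only [Finset.sum_mul, Finset.mul_sum, smul_mul_assoc, mul_smul_comm, ← Finset.sum_sub_distrib,
    ← smul_sub, ftv_momentumNumber_mul_transfer _ k k' _ σ hkk', add_sub_cancel_left]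
  simp only [smul_sub, Finset.sum_sub_distrib, ite_and, smul_ite, smul_zero, Finset.sum_ite_eq',
    Finset.mem_univ, if_true]
  rw [Complex.ofReal_sub, sub_smul]

/-- `[Q_f, c†_{kσ} c_{k'σ}] = 0` for every spin-weighted charge `Q_f = Σ f(τ) n_{xτ}`: the same-spin transfer
carries no charge (`[Q_f, c†_{kσ}] = f(σ) c†_{kσ}`, `[Q_f, c_{k'σ}] = −f(σ) c_{k'σ}`). Tasaki (2020) §9.3. [folklore] -/
theorem ftv_spinWeightedNumber_commute_transfer (f : Fin 2 → ℂ) (k k' : TorusSite 2 L) (σ : Fin 2) :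
    Commute (spinWeightedNumber f) (momentumCreation k σ * momentumAnnihilation k' σ) := by
  rw [Commute, SemiconjBy, ← sub_eq_zero, commutator_mul_expand,
    spinWeightedNumber_commutator_momentumCreation, spinWeightedNumber_commutator_momentumAnnihilation,
    smul_mul_assoc, mul_neg, mul_smul_comm, add_neg_cancel]

/-- **The same-spin transfer `c†_{kσ} c_{k'σ}` maps every joint sector `szSector N M` into itself** (it commutes
with `N = Q_1` and `S^z = Q_{(½,−½)}`). Lieb, PRL 62 (1989) 1201. [folklore] -/
theorem ftv_transfer_mulVec_mem_szSector (k k' : TorusSite 2 L) (σ : Fin 2) {N : ℕ} {M : ℝ}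
    {v : Fock (Orb (FermionTorus 2 L))} (hv : v ∈ szSector N M) :
    (momentumCreation k σ * momentumAnnihilation k' σ) *ᵥ v ∈ szSector N M := by
  refine mulVec_mem_szSector_of_commute ?_ ?_ hv
  · rw [totalNumber_eq_spinWeightedNumber]
    exact (ftv_spinWeightedNumber_commute_transfer _ k k' σ).symm
  · rw [spinZ_eq_spinWeightedNumber]
    exact (ftv_spinWeightedNumber_commute_transfer _ k k' σ).symm

end Transfer

section Registered

/-- **Stub S2 — transfers to lower levels annihilate free sector ground states.** For a ground state `ψ`
of `H₀ = hubbardTorus 2 L 1 0` (`L ≥ 3`) in the sector `(N, S^z = M)` and levels `ε_L(k) < ε_L(k')`: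
`c†_{kσ} c_{k'σ} ψ = 0`. Proof: `[H₀, c†_{kσ}c_{k'σ}] = (ε_L(k) − ε_L(k')) c†_{kσ}c_{k'σ}`
(`ftv_hubbardTorus_zero_commutator_transfer`), the transfer preserves `szSector N M`
(`ftv_transfer_mulVec_mem_szSector`), so the one-sided KKT lever `eucNorm_mulVec_le_of_approxLowering` with
`ω = ε_L(k') − ε_L(k) > 0` and zero remainder gives `ω ‖c†c ψ‖ ≤ 0`. Lieb–Loss, *Analysis* (2001) Thm 1.14
(aufbau); Bardeen–Cooper–Schrieffer (1957) §II. [folklore] -/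
theorem stub_freeTransferVanishes : ∀ (L : ℕ) [NeZero L], 3 ≤ L → ∀ (N : ℕ) (M : ℝ)
    (ψ : Fock (Orb (FermionTorus 2 L))), IsGroundStateInSector (hubbardTorus 2 L 1 0) N M ψ →
    ∀ (k k' : TorusSite 2 L) (σ : Fin 2), torusBand L k < torusBand L k' →
      (momentumCreation k σ * momentumAnnihilation k' σ) *ᵥ ψ = 0 := by
  intro L _ hL N M ψ hψ k k' σ hlt
  have hkk' : k ≠ k' := fun h => hlt.ne (congrArg (torusBand L) h)
  -- the lever with `B = c†_{kσ} c_{k'σ}`, `K' = szSector N M`, `ω = ε_L(k') − ε_L(k)`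
  have hlev := eucNorm_mulVec_le_of_approxLowering (H := hubbardTorus 2 L 1 0)
    (szSector (Λ := FermionTorus 2 L) N M) (momentumCreation k σ * momentumAnnihilation k' σ)
    (torusBand L k' - torusBand L k) hψ.2.2 (ftv_transfer_mulVec_mem_szSector k k' σ hψ.1)
  -- zero remainder: `[H₀, X] + ω X = (ε_k − ε_k') X + (ε_k' − ε_k) X = 0`
  have hrem : hubbardTorus 2 L 1 0 * (momentumCreation k σ * momentumAnnihilation k' σ) -
      momentumCreation k σ * momentumAnnihilation k' σ * hubbardTorus 2 L 1 0 +
      ((torusBand L k' - torusBand L k : ℝ) : ℂ) • (momentumCreation k σ * momentumAnnihilation k' σ) = 0 := by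
    rw [ftv_hubbardTorus_zero_commutator_transfer hL hkk' σ, ← add_smul, ← Complex.ofReal_add,
      sub_add_sub_cancel, sub_self, Complex.ofReal_zero, zero_smul]
  rw [hrem, Matrix.zero_mulVec, eucNorm_zero, sub_self, sub_zero] at hlev
  -- `ω > 0` and `ω ‖Xψ‖ ≤ 0` force `‖Xψ‖ = 0`
  have hω : 0 < torusBand L k' - torusBand L k := sub_pos.2 hlt
  have h0 : eucNorm ((momentumCreation k σ * momentumAnnihilation k' σ) *ᵥ ψ) = 0 :=
    le_antisymm (not_lt.1 fun h => absurd hlev (not_le.2 (mul_pos hω h))) (eucNorm_nonneg _)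
  have h2 : star ((momentumCreation k σ * momentumAnnihilation k' σ) *ᵥ ψ) ⬝ᵥ
      ((momentumCreation k σ * momentumAnnihilation k' σ) *ᵥ ψ) = 0 := by
    rw [star_dotProduct_self_eq_eucNorm_sq, h0]
    norm_num
  exact dotProduct_star_self_eq_zero.1 h2

end Registered

end Summit.HubbardSuperconductivity.HubbardSuperconductivity.Theorems.WindowInfraredBound
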